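import Summits.RiemannHypothesis.RiemannHypothesis.Theorems.GroundBartaPolarPerronFrobeniusThetaWindowCollar
import Summits.RiemannHypothesis.RiemannHypothesis.Theorems.GroundBartaPolarPerronFrobeniusThetaWindowImageReduction
import Summits.RiemannHypothesis.RiemannHypothesis.Theorems.GroundBartaGroundBartaFloorLeakageSign
import Summits.RiemannHypothesis.RiemannHypothesis.Theorems.WeilGroundStateGroundStatesConvergeToXiStubHarmonicExtension
import Mathlib.Analysis.SpecialFunctions.ImproperIntegrals
import Mathlib.Analysis.PSeries
import HarnessLib

/-!
# The collar estimate: translates of the collar tail against Weil's functional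
(route `RiemannHypothesis/GroundBarta`, rung 3 `PolarPerronFrobenius`, stmt-RiemannHypothesis-18390 —
theta-vector toolkit; closes the analytic content of item `ThetaWindowImage`,
stmt-RiemannHypothesis-19848, of the draft route `EvenThetaVisibilityPinning`)

For `a ≥ 2`, `x = e^{2a}`, `|u| ≤ a`, and the collar tail `κ_a = Φ(1 − χ_a)` of the smooth theta
window vector (`= 0` on `|s| ≤ b = a − e^{−2a}`, `≤ K₀ x^{9/4}e^{−πx}`, `|κ_a′| ≤ K₁ x^{13/4}e^{−πx}`,
Theorems/GroundBartaPolarPerronFrobeniusThetaWindowCollar.lean), the translate `f = κ_a(· + u)` has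

* polar term `e^{u/2}κ̂_a(0) + e^{−u/2}κ̂_a(1)`, bounded by `2e^{a/2}ϖ_b ≤ 8 phiUpper e^{2π} x^{11/4} e^{−πx}`;
* prime term `Σ Λ(n)n^{-1/2}(κ_a(log n + u) + κ_a(log n − u)) ≥ 0`, bounded by
  `4 phiUpper e^{2π} Z x^{9/4+β} e^{−πx}`, `β = 2π − 9/2`, `Z = Σ n^{1/2−β}` (the tail decays like
  `e^{−β(s−b)}` beyond the bulk radius, and `Λ(n)/√n ≤ √n`);
* archimedean term (Bombieri's form on the exponential class), bounded by
  `(log 4π + γ)·sup κ_a + 2e^{1/2}(9 sup κ_a + sup|κ_a′|)` (mean value theorem near `0`, decay of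
  `1/sinh` at infinity).
Hence `‖W(τ_u κ_a)‖ ≤ C x^{9/4+β} e^{−πx}` (`weilFunctional_translate_collarTail_le`), which is the
hypothesis of `thetaWindowImage_of_translate_bound`.  RH-free.
References: Bombieri 2000 Thm 2 (explicit formula, archimedean term); de Bruijn (kernel `Φ`).
-/

set_option linter.dupNamespace false

noncomputable section

open Set MeasureTheory Filter Complex
open scoped Real Topology ComplexConjugate ArithmeticFunction.vonMangoldt

namespace Summit.RiemannHypothesis.RiemannHypothesis.Theorems.PolarPerronFrobenius

open Literature.NumberTheory.LFunctions
open Summit.RiemannHypothesis.RiemannHypothesis.Theorems.GroundBartaFloor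
open Summit.RiemannHypothesis.RiemannHypothesis.Theorems.GroundStatesConvergeToXi

/-- The real collar tail `κ_a = Φ (1 - χ_a)`. -/
local notation "κr[" a "]" => (fun t : ℝ =>
  weilThetaPhi t * (1 - Real.smoothTransition ((a - t) * Real.exp (2 * a)) *
    Real.smoothTransition ((a + t) * Real.exp (2 * a))))

/-- The collar tail `κ_a = Φ (1 - χ_a)`, complexified. -/
local notation "κ[" a "]" => (fun t : ℝ =>
  ((weilThetaPhi t * (1 - Real.smoothTransition ((a - t) * Real.exp (2 * a)) *
    Real.smoothTransition ((a + t) * Real.exp (2 * a))) : ℝ) : ℂ))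

/-! ## Basic facts on the real collar tail -/

/-- The real collar tail is continuous, even, with `0 ≤ κ_a ≤ Φ` and `κ_a = 0` on `[-b, b]`,
`b = a − e^{−2a}` (`a ≥ 2`). [folklore] -/
theorem collarTail_basic {a : ℝ} (ha : 2 ≤ a) :
    Continuous κr[a] ∧ (∀ t, κr[a] (-t) = κr[a] t) ∧ (∀ t, 0 ≤ κr[a] t) ∧
      (∀ t, κr[a] t ≤ weilThetaPhi t) ∧
      ∀ t ∈ Icc (-(a - rexp (-(2 * a)))) (a - rexp (-(2 * a))), κr[a] t = 0 := by
  refine ⟨?_, fun t => ?_, fun t => (collarTail_values ha t).1, fun t => (collarTail_values ha t).2.1,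
    fun t ht => (collarTail_values ha t).2.2.1 (abs_le.2 ⟨ht.1, ht.2⟩)⟩
  · exact continuous_weilThetaPhi.mul (continuous_const.sub (thetaWin_cutoff_contDiff a).continuous)
  · have h := thetaWin_cutoff_neg a t
    simp only at h
    simp only [weilThetaPhi_neg, h]

/-! ## The polar term -/

/-- **Polar term of the translated collar tail**: for `a ≥ 2`, `|u| ≤ a`,
`‖polar(τ_u κ_a)‖ ≤ 8 phiUpper e^{2π} x^{11/4} e^{−πx}`, `x = e^{2a}`. [folklore] -/
theorem collarTail_polar_le {a u : ℝ} (ha : 2 ≤ a) (hu : |u| ≤ a) :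
    ‖weilPolarTerm (fun t => κ[a] (t + u))‖ ≤
      8 * phiUpper * rexp (2 * π) * rexp (2 * a) ^ (11 / 4 : ℝ) * rexp (-(π * rexp (2 * a))) := by
  obtain ⟨hb1, hba, -⟩ := collar_geometry ha
  obtain ⟨hκc, -, hκ0, hκΦ, hκz⟩ := collarTail_basic ha
  set b := a - rexp (-(2 * a)) with hb
  have hφ := phiUpper_pos
  have hexp := collar_exp_le ha
  -- the transforms at `0, 1` are the real moments `K₀, K₁ ≤ ϖ_b`
  set K₀ : ℝ := ∫ t, κr[a] t * Real.exp (-(1 / 2) * t) with hK₀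
  set K₁ : ℝ := ∫ t, κr[a] t * Real.exp (1 / 2 * t) with hK₁
  have hM0 : weilMellin κ[a] 0 = ((K₀ : ℝ) : ℂ) :=
    leakSign_weilMellin_ofReal κr[a] (by push_cast; ring)
  have hM1 : weilMellin κ[a] 1 = ((K₁ : ℝ) : ℂ) :=
    leakSign_weilMellin_ofReal κr[a] (by push_cast; ring)
  have hK₀0 : 0 ≤ K₀ := integral_nonneg fun t => mul_nonneg (hκ0 t) (Real.exp_pos _).le
  have hK₁0 : 0 ≤ K₁ := integral_nonneg fun t => mul_nonneg (hκ0 t) (Real.exp_pos _).le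
  have hb0 : 0 ≤ b := by linarith
  have hK₀le : K₀ ≤ groundThetaPolarWeight b :=
    leakSign_integral_mul_exp_neg_half_le hb0 hκc hκ0 hκΦ hκz
  have hK₁le : K₁ ≤ groundThetaPolarWeight b :=
    leakSign_integral_mul_exp_half_le hb0 hκc hκ0 hκΦ hκz
  -- `ϖ_b ≤ 4 phiUpper e^{5b − πe^{2b}} ≤ 4 phiUpper e^{2π} x^{5/2} e^{−πx}`
  have hϖ : groundThetaPolarWeight b ≤ 4 * phiUpper * rexp (2 * π) * rexp (2 * a) ^ (5 / 2 : ℝ) *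
      rexp (-(π * rexp (2 * a))) := by
    refine (rateDecay_polarWeight_le hb1).trans ?_
    have hden : 1 ≤ π * rexp (2 * b) := by
      have := Real.one_le_exp (show 0 ≤ 2 * b by linarith)
      nlinarith [Real.pi_gt_three]
    have hnum : 0 ≤ 4 * phiUpper * rexp (5 * b - π * rexp (2 * b)) := by positivity
    refine (div_le_self hnum hden).trans ?_
    rw [Real.exp_sub, div_eq_mul_inv, ← Real.exp_neg]
    have h5 : rexp (5 * b) ≤ rexp (2 * a) ^ (5 / 2 : ℝ) := by
      rw [← Real.exp_mul]; exact Real.exp_le_exp.2 (by nlinarith [Real.exp_pos (-(2 * a))])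
    calc 4 * phiUpper * (rexp (5 * b) * rexp (-(π * rexp (2 * b))))
        ≤ 4 * phiUpper * (rexp (2 * a) ^ (5 / 2 : ℝ) * (rexp (2 * π) * rexp (-(π * rexp (2 * a))))) := by gcongr
      _ = _ := by ring
  -- `e^{±u/2} ≤ e^{a/2} ≤ x^{1/4}`
  have heu : ∀ v : ℝ, |v| ≤ a → ‖cexp ((v : ℂ) / 2)‖ ≤ rexp (2 * a) ^ (1 / 4 : ℝ) := fun v hv => by
    rw [show (v : ℂ) / 2 = ((v / 2 : ℝ) : ℂ) by push_cast; ring, Complex.norm_exp_ofReal,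
      ← Real.exp_mul]
    exact Real.exp_le_exp.2 (by linarith [(abs_le.1 hv).2])
  have heu' : ‖cexp (-((u : ℂ) / 2))‖ ≤ rexp (2 * a) ^ (1 / 4 : ℝ) := by
    have h := heu (-u) (by rwa [abs_neg])
    rwa [show ((-u : ℝ) : ℂ) / 2 = -((u : ℂ) / 2) by push_cast; ring] at h
  have hP := wi_weilPolarTerm_translate κ[a] u
  simp only at hP ⊢
  rw [hP, hM0, hM1]
  have hx14 : 0 ≤ rexp (2 * a) ^ (1 / 4 : ℝ) := by positivity
  calc ‖cexp ((u : ℂ) / 2) * ((K₀ : ℝ) : ℂ) + cexp (-((u : ℂ) / 2)) * ((K₁ : ℝ) : ℂ)‖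
      ≤ ‖cexp ((u : ℂ) / 2)‖ * K₀ + ‖cexp (-((u : ℂ) / 2))‖ * K₁ := by
        refine (norm_add_le _ _).trans (le_of_eq ?_)
        rw [norm_mul, norm_mul, Complex.norm_real, Complex.norm_real, Real.norm_of_nonneg hK₀0,
          Real.norm_of_nonneg hK₁0]
    _ ≤ rexp (2 * a) ^ (1 / 4 : ℝ) * groundThetaPolarWeight b + rexp (2 * a) ^ (1 / 4 : ℝ) * groundThetaPolarWeight b :=
        add_le_add (mul_le_mul (heu u hu) hK₀le hK₀0 hx14) (mul_le_mul heu' hK₁le hK₁0 hx14)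
    _ = 2 * (rexp (2 * a) ^ (1 / 4 : ℝ) * groundThetaPolarWeight b) := by ring
    _ ≤ 2 * (rexp (2 * a) ^ (1 / 4 : ℝ) * (4 * phiUpper * rexp (2 * π) * rexp (2 * a) ^ (5 / 2 : ℝ) * rexp (-(π * rexp (2 * a))))) := by
        gcongr
    _ = 8 * phiUpper * rexp (2 * π) * (rexp (2 * a) ^ (1 / 4 : ℝ) * rexp (2 * a) ^ (5 / 2 : ℝ)) * rexp (-(π * rexp (2 * a))) := by ring
    _ = 8 * phiUpper * rexp (2 * π) * rexp (2 * a) ^ (11 / 4 : ℝ) * rexp (-(π * rexp (2 * a))) := by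
        rw [← Real.rpow_add (Real.exp_pos _)]; norm_num

/-! ## The prime term -/

/-- Decay of the envelope beyond the bulk radius: for `0 ≤ b ≤ s`,
`e^{9s/2 − πe^{2s}} ≤ e^{9b/2 − πe^{2b}} · e^{−β(s − b)}`, `β = 2π − 9/2`. [folklore] -/
theorem collar_envelope_decay {b s : ℝ} (hb : 0 ≤ b) (hbs : b ≤ s) :
    rexp (9 / 2 * s - π * rexp (2 * s)) ≤
      rexp (9 / 2 * b - π * rexp (2 * b)) * rexp (-((2 * π - 9 / 2) * (s - b))) := by
  rw [← Real.exp_add]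
  apply Real.exp_le_exp.2
  have h1 : 1 + 2 * (s - b) ≤ rexp (2 * (s - b)) := by linarith [Real.add_one_le_exp (2 * (s - b))]
  have h2 : rexp (2 * s) = rexp (2 * b) * rexp (2 * (s - b)) := by rw [← Real.exp_add]; congr 1; ring
  have h3 : 1 ≤ rexp (2 * b) := Real.one_le_exp (by linarith)
  have h4 : 2 * (s - b) ≤ rexp (2 * s) - rexp (2 * b) := by
    rw [h2]; nlinarith [Real.exp_pos (2 * b), sub_nonneg.2 hbs]
  nlinarith [Real.pi_pos]

/-- **Shifted values of the collar tail**: for `a ≥ 2`, `|v| ≤ a`, `n ≥ 2`,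
`κ_a(log n + v) ≤ 2 phiUpper e^{9b/2 − πe^{2b}} e^{2βa} · n^{−β}`, `β = 2π − 9/2`. [folklore] -/
theorem collarTail_shift_le {a v : ℝ} (ha : 2 ≤ a) (hv : |v| ≤ a) {n : ℕ} (hn : 2 ≤ n) :
    κr[a] (Real.log n + v) ≤
      2 * phiUpper * rexp (9 / 2 * (a - rexp (-(2 * a))) - π * rexp (2 * (a - rexp (-(2 * a))))) *
        rexp ((2 * π - 9 / 2) * (2 * a)) * (n : ℝ) ^ (-(2 * π - 9 / 2)) := by
  obtain ⟨hb1, hba, -⟩ := collar_geometry ha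
  set b := a - rexp (-(2 * a)) with hb
  set β : ℝ := 2 * π - 9 / 2 with hβ
  have hφ := phiUpper_pos
  have hn0 : (0 : ℝ) < n := by exact_mod_cast (by omega : 0 < n)
  set s : ℝ := Real.log n + v with hs
  obtain ⟨h0, hΦ, hzero, -⟩ := collarTail_values ha s
  by_cases hz : κr[a] s = 0
  · rw [hz]; positivity
  -- `s > b`: `|s| > b` (else `κ_a(s) = 0`) and `s > -b` (`log n ≥ log 2 > e^{-2a}`)
  have hsb' : b < |s| := by
    by_contra h; push Not at h; exact hz (hzero h)
  have hlog2 : Real.log 2 ≤ Real.log n := Real.log_le_log two_pos (by exact_mod_cast hn)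
  have hsmall : rexp (-(2 * a)) < Real.log 2 := by
    have h1 : rexp (-(2 * a)) ≤ rexp (-4) := Real.exp_le_exp.2 (by linarith)
    have h2 : rexp (-4) < 1 / 2 := by
      rw [Real.exp_neg, inv_lt_comm₀ (Real.exp_pos _) (by norm_num)]
      linarith [Real.add_one_le_exp (4 : ℝ)]
    linarith [Real.log_two_gt_d9]
  have hsgt : -b < s := by
    have := (abs_le.1 hv).1
    rw [hs, hb]; linarith
  have hbs : b < s := by
    rcases le_or_gt 0 s with h | h
    · rwa [abs_of_nonneg h] at hsb'
    · rw [abs_of_neg h] at hsb'; linarith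
  have hs0 : 0 ≤ s := by linarith
  -- envelope
  calc κr[a] s ≤ weilThetaPhi s := hΦ
    _ ≤ 2 * phiUpper * rexp (9 / 2 * s - π * rexp (2 * s)) := rateDecay_phi_upper hs0
    _ ≤ 2 * phiUpper * (rexp (9 / 2 * b - π * rexp (2 * b)) * rexp (-(β * (s - b)))) :=
        mul_le_mul_of_nonneg_left (collar_envelope_decay (by linarith) hbs.le) (by positivity)
    _ ≤ 2 * phiUpper * (rexp (9 / 2 * b - π * rexp (2 * b)) * (rexp (β * (2 * a)) * (n : ℝ) ^ (-β))) := by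
        gcongr
        -- `e^{−β(s−b)} = e^{−β log n} e^{β(b − v)} ≤ n^{−β} e^{2βa}`
        rw [Real.rpow_def_of_pos hn0, ← Real.exp_add]
        apply Real.exp_le_exp.2
        have hβ0 : 0 ≤ β := by rw [hβ]; linarith [Real.pi_gt_three]
        have : b - v ≤ 2 * a := by linarith [(abs_le.1 hv).1]
        rw [hs]
        nlinarith
    _ = _ := by ring

/-- **Prime term of the translated collar tail**: for `a ≥ 2`, `|u| ≤ a`,
`‖prime(τ_u κ_a)‖ ≤ 4 phiUpper e^{2π} Z · x^{9/4 + β} e^{−πx}`, `β = 2π − 9/2`,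
`Z = Σ_n n^{1/2−β}`. [folklore] -/
theorem collarTail_prime_le {a u : ℝ} (ha : 2 ≤ a) (hu : |u| ≤ a) :
    ‖weilPrimeTerm (fun t => κ[a] (t + u))‖ ≤
      4 * phiUpper * rexp (2 * π) * (∑' n : ℕ, (n : ℝ) ^ (1 / 2 - (2 * π - 9 / 2))) *
        rexp (2 * a) ^ (9 / 4 + (2 * π - 9 / 2)) * rexp (-(π * rexp (2 * a))) := by
  obtain ⟨hb1, hba, -⟩ := collar_geometry ha
  obtain ⟨-, heven, hκ0, -, -⟩ := collarTail_basic ha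
  set b := a - rexp (-(2 * a)) with hb
  set β : ℝ := 2 * π - 9 / 2 with hβ
  have hφ := phiUpper_pos
  have hβ32 : 3 / 2 < β := by rw [hβ]; linarith [Real.pi_gt_three]
  -- the constant `A = 2 phiUpper E9b e^{2βa}` and its conversion
  set E9 : ℝ := rexp (9 / 2 * b - π * rexp (2 * b)) with hE9
  set A : ℝ := 2 * phiUpper * E9 * rexp (β * (2 * a)) with hA
  have hA0 : 0 ≤ A := by positivity
  have hexp := collar_exp_le ha
  have hAx : A ≤ 2 * phiUpper * rexp (2 * π) * rexp (2 * a) ^ (9 / 4 + β) * rexp (-(π * rexp (2 * a))) := by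
    rw [hA, hE9, Real.exp_sub, div_eq_mul_inv, ← Real.exp_neg]
    have h9 : rexp (9 / 2 * b) * rexp (β * (2 * a)) ≤ rexp (2 * a) ^ (9 / 4 + β) := by
      rw [← Real.exp_add, ← Real.exp_mul]
      exact Real.exp_le_exp.2 (by nlinarith [Real.exp_pos (-(2 * a)), Real.pi_gt_three])
    calc 2 * phiUpper * (rexp (9 / 2 * b) * rexp (-(π * rexp (2 * b)))) * rexp (β * (2 * a))
        = 2 * phiUpper * (rexp (9 / 2 * b) * rexp (β * (2 * a))) * rexp (-(π * rexp (2 * b))) := by ring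
      _ ≤ 2 * phiUpper * rexp (2 * a) ^ (9 / 4 + β) * (rexp (2 * π) * rexp (-(π * rexp (2 * a)))) := by
          gcongr
      _ = _ := by ring
  -- the summable majorant
  have hsum : Summable fun n : ℕ => (n : ℝ) ^ (1 / 2 - β) :=
    Real.summable_nat_rpow.2 (by linarith)
  set Z : ℝ := ∑' n : ℕ, (n : ℝ) ^ (1 / 2 - β) with hZ
  have hmaj : HasSum (fun n : ℕ => 2 * A * (n : ℝ) ^ (1 / 2 - β)) (2 * A * Z) := hsum.hasSum.mul_left _
  -- termwise bound
  have hterm : ∀ n : ℕ, ‖((Λ n : ℝ) : ℂ) / (Real.sqrt n : ℂ) *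
      (κ[a] (Real.log n + u) + κ[a] (-Real.log n + u))‖ ≤ 2 * A * (n : ℝ) ^ (1 / 2 - β) := by
    intro n
    have hre : ((Λ n : ℝ) : ℂ) / (Real.sqrt n : ℂ) * (κ[a] (Real.log n + u) + κ[a] (-Real.log n + u)) =
        (((Λ n : ℝ) / Real.sqrt n * (κr[a] (Real.log n + u) + κr[a] (-Real.log n + u)) : ℝ) : ℂ) := by
      push_cast; ring
    rw [hre, Complex.norm_real, Real.norm_of_nonneg (mul_nonneg
      (div_nonneg ArithmeticFunction.vonMangoldt_nonneg (Real.sqrt_nonneg _))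
      (add_nonneg (hκ0 _) (hκ0 _)))]
    rcases Nat.lt_or_ge n 2 with hn | hn
    · -- `n = 0, 1`: the coefficient vanishes
      interval_cases n
      · simp
        positivity
      · simp [ArithmeticFunction.vonMangoldt_apply_one]; positivity
    · have hn0 : (0 : ℝ) < n := by exact_mod_cast (by omega : 0 < n)
      -- `Λ(n)/√n ≤ √n = n^{1/2}`
      have hc : (Λ n : ℝ) / Real.sqrt n ≤ (n : ℝ) ^ (1 / 2 : ℝ) := by
        rw [← Real.sqrt_eq_rpow, div_le_iff₀ (Real.sqrt_pos.2 hn0), Real.mul_self_sqrt hn0.le]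
        exact ArithmeticFunction.vonMangoldt_le_log.trans ((Real.log_le_sub_one_of_pos hn0).trans (by linarith))
      -- the two shifted values
      have h1 := collarTail_shift_le ha hu hn
      have h2 := collarTail_shift_le (v := -u) ha (by rwa [abs_neg]) hn
      have e2 : κr[a] (-Real.log n + u) = κr[a] (Real.log n + -u) := by
        rw [← heven]; congr 1; ring
      rw [e2]
      have hsum2 : κr[a] (Real.log n + u) + κr[a] (Real.log n + -u) ≤ 2 * (A * (n : ℝ) ^ (-β)) := by
        have e : 2 * phiUpper * rexp (9 / 2 * (a - rexp (-(2 * a))) - π * rexp (2 * (a - rexp (-(2 * a))))) *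
            rexp ((2 * π - 9 / 2) * (2 * a)) * (n : ℝ) ^ (-(2 * π - 9 / 2)) = A * (n : ℝ) ^ (-β) := by
          rw [hA, hE9, hβ, hb]
        linarith [h1.trans_eq e, h2.trans_eq e]
      calc (Λ n : ℝ) / Real.sqrt n * (κr[a] (Real.log n + u) + κr[a] (Real.log n + -u))
          ≤ (n : ℝ) ^ (1 / 2 : ℝ) * (2 * (A * (n : ℝ) ^ (-β))) :=
            mul_le_mul hc hsum2 (add_nonneg (hκ0 _) (hκ0 _)) (by positivity)
        _ = 2 * A * ((n : ℝ) ^ (1 / 2 : ℝ) * (n : ℝ) ^ (-β)) := by ring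
        _ = 2 * A * (n : ℝ) ^ (1 / 2 - β) := by
            rw [← Real.rpow_add hn0]; ring_nf
  have hbound : ‖weilPrimeTerm (fun t => κ[a] (t + u))‖ ≤ 2 * A * Z := by
    unfold weilPrimeTerm
    refine tsum_of_norm_bounded hmaj fun n => ?_
    simp only
    exact hterm n
  refine hbound.trans ?_
  have hZ0 : 0 ≤ Z := tsum_nonneg fun n => by positivity
  calc 2 * A * Z ≤ 2 * (2 * phiUpper * rexp (2 * π) * rexp (2 * a) ^ (9 / 4 + β) *
        rexp (-(π * rexp (2 * a)))) * Z := by gcongr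
    _ = _ := by ring

end Summit.RiemannHypothesis.RiemannHypothesis.Theorems.PolarPerronFrobenius

end
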